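import Summits.QuantumFields.BalabanUV.T4Continuum.Support.NE3ShapeClassSixTorus
import Summits.QuantumFields.BalabanUV.T4Continuum.Support.NE3ClassSixFlatWitness
import HarnessLib

/-!
# T⁴ programme, node NE3 — JOINT NON-VACUITY OF THE CLASS-(6) CAPSTONE `ne3Shape_classSix_crude` ((57S)):
# `NE3Shape` BY NAME over B11's class (6), HYPOTHESIS-FREE, at the flat datum

NE3 formalisation swarm `b2b-balaban-t4-ne3-formalise-*`, LEAF PROVER 04 (unit `b2b-balaban-t4-ne3-formalise-leaf-04`,
gen 3), support node «A-NV-joint» of `t4/formal/NE3/LEAVES.md` (typer ρ59), file 4: the owner's class-(6) capstone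
`NE3ShapeClassSixTorus.ne3Shape_classSix_crude` (p216303) concludes `T4EtaRateMin.NE3Shape … (L⁻¹)` over `ClassSix 4 L N ε₀`
from FOUR typed hypotheses — (H∃) in choice form, the transport (M2) (`h4`), P2's ROOT T-E (`hTE`) and the regime.  At the
FLAT datum all four are DISCHARGED by file 3 (`NE3ClassSixFlatWitness`: `isMinimiser_classSix_flatCfg`, `regularSup_flatCfg`,
`rescale_bavg_mem_classSix_of_isMinimiser_flatCfg`, `ne3EnergyRate_classSix_flat`) and the corner `b = c = t = B = C_r = 0`:
**`ne3Shape_classSix_crude_flat`**: `NE3Shape (minActReadings 4 (ClassSix 4 L N ε₀) L N {flatCfg} loc_D) (max C_A 0) (L⁻¹)`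
for every `L ≥ 2`, `N ≥ 1`, `ε₀ > 0` (stated for every `C ≥ 0`; the crude (D) constant vanishes at the corner).

HONEST FRAMING.  NON-VACUITY at the FLAT datum only: the class-(6) capstone's hypothesis set is jointly satisfiable on ONE
class family and one datum; nothing about Bałaban's minimisers at a non-flat datum, where (H∃) ([Balaban1985Variational]
Thm 1 TYPE), (M2) ([Balaban1985RegularSpaces] Prop. 3 TYPE) and T-E remain HYPOTHESES; NE3 is NOT proved; `K_D ∝ N⁴`
(fixed torus).  No estimate of the cell is touched; no conditional of the cell (`BetaPertH`, (B), (B^μ), G-an2-4) is used or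
hidden; nothing printed is a hypothesis of a theorem; no `def`, no `sorry`, axioms ⊆ {propext, Classical.choice, Quot.sound}.
Finite T⁴ rung (B)+1 — NOT infinite volume, NOT a mass gap, NOT the Clay problem, NOT summit progress.  PLACEMENT:
`Summits/QuantumFields/BalabanUV/`.  HONEST DEPENDENCY (cell page 1): continuum YM on T⁴ ⇐ BetaPertH ∧ nine spine
estimates (0/9 proved); BetaPertH ⇐ (D1) ∧ (D4) ∧ CAP+tail; G-an2-4 gates asym, D1 and NE2/3/4.
-/

set_option autoImplicit false

open scoped BigOperators Matrix Matrix.Norms.L2Operator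
open NormedSpace Finset

namespace Summit.QuantumFields.BalabanUV.T4Continuum.NE3ShapeClassSixWitness

open Literature.MathematicalPhysics.QuantumFieldTheory.Balaban1983to89
open B7Prop1Explicit B7Prop2Explicit
open T4AveragingDeficitWall hiding Site Plane Plaq Bond
open T4AveragingDeficitWallBoundary (periodBox)
open T4AveragingDeficitNonAbelian (wallConstNA wallConstLoc)
open T4EtaRateMin (NE3Shape)
open AveragingDeficitDualResidual (dualC1 dualC2)
open AveragingDeficitDerivWallProof (wallConst)
open MinimalActionSandwich MinimalActionRate MinimalActionRefine
open MinimalActionWitness (flatCfg)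
open MinimalActionClassSix (ClassSix)
open NE3ShapeClassSixTorus (ne3Shape_classSix_crude)
open NE3ClassSixFlatWitness (isMinimiser_classSix_flatCfg rescale_bavg_mem_classSix_of_isMinimiser_flatCfg
  ne3EnergyRate_classSix_flat)

noncomputable section

variable {n : Type*} [Fintype n] [DecidableEq n] [Nonempty n]

/-- **THE CLASS-(6) CAPSTONE ON ONE CLASS FAMILY AND ONE DATUM, HYPOTHESIS-FREE**: for `L ≥ 2`, `N ≥ 1`, `ε₀ > 0`,
`C ≥ 0`, `NE3Shape (minActReadings 4 (ClassSix 4 L N ε₀) L N {flatCfg} loc_D) (max C_A 0) (L⁻¹)` — the owner's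
`ne3Shape_classSix_crude` (p216303) at `dom = {flatCfg}`, `sel = flatCfg`, corner `b = c = t = B = C_r = 0`, with (H∃)
(`isMinimiser_classSix_flatCfg` + `regularSup_flatCfg`), (M2) (`rescale_bavg_mem_classSix_of_isMinimiser_flatCfg`) and T-E
(`ne3EnergyRate_classSix_flat`) ALL DISCHARGED; the crude (D) constant vanishes (`gradConst 4 0 = 0`).  Non-vacuity only;
NE3 NOT proved. [folklore] -/
theorem ne3Shape_classSix_crude_flat {L N : ℕ} (hL : 2 ≤ L) (hN : 1 ≤ N) {ε₀ C : ℝ} (hε : 0 < ε₀) (hC : 0 ≤ C) :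
    NE3Shape
      (minActReadings 4 (ClassSix (n := n) 4 L N ε₀) L N {flatCfg}
        (fun k (_ : Site 4 → Fin 4 → (Matrix n n ℂ)ˣ) (x : ↥(periodBox (d := 4) N)) =>
          fineAction (flatCfg : Site 4 → Fin 4 → (Matrix n n ℂ)ˣ) (((blockSites L)^[k] {(x : Site 4)}) ×ˢ Finset.univ)))
      (max (wallConstNA 4 L * (gradConst 4 1 + 1) / (L : ℝ) ^ 2) 0)
      ((L : ℝ)⁻¹) := by
  have hL1 : 1 ≤ L := le_trans (by norm_num) hL
  have h := ne3Shape_classSix_crude (d := 4) (n := n) rfl hL hN (b := 0) (c := 0) (t := 0) (B := 0) (C_r := 0) (C := C)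
    (ε₀ := ε₀) le_rfl le_rfl le_rfl le_rfl hC le_rfl (by norm_num) hε (by simpa using hε) (by norm_num)
    (by rw [mul_zero]; exact zero_le_one) (by rw [mul_zero]; exact zero_le_one) (by rw [mul_zero]; exact zero_le_one)
    (by rw [mul_zero]) (by rw [mul_zero])
    (ne3EnergyRate_classSix_flat (d := 4) hL1 hN hε 0 (gradConst 4 0) hC)
    (sel := fun _ _ => flatCfg)
    (fun V hV k => by rw [Set.mem_singleton_iff] at hV; subst hV; exact isMinimiser_classSix_flatCfg hL1 N hε k)
    (fun V hV k => by rw [Set.mem_singleton_iff] at hV; subst hV; exact regularSup_flatCfg L N k le_rfl le_rfl)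
    (fun V hV k U hU _ => by
      rw [Set.mem_singleton_iff] at hV
      subst hV
      exact rescale_bavg_mem_classSix_of_isMinimiser_flatCfg hL1 hN hε hU)
  convert h using 3
  simp [MinimalActionRefine.gradConst]

end

end Summit.QuantumFields.BalabanUV.T4Continuum.NE3ShapeClassSixWitness
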